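import Mathlib
import Literature.NumberTheory.DiophantineGeometry.NoncriticalBelyiGenusZero
import Literature.NumberTheory.DiophantineGeometry.NoncriticalBelyiSubst

/-!
# Noncritical Belyi maps on `ℙ¹_ℚ` protecting `∞` AND a prescribed finite Galois-stable set

[NCBelyi] Thm. 2.5 [cite: MochizukiNCBelyi2004] for `X = ℙ¹_ℚ` with a general finite protected set
`T = {∞} ∪ {roots of G}` (`G ∈ ℚ[x]` nonzero; we pass to its radical), i.e. Scherr–Zieve
[cite: ScherrZieve2014] Thm. 1 for `C = ℙ¹` (minus the "ramified at `S`" refinement): compose the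
`∞`-protecting Belyi pair of `NoncriticalBelyiGenusZero.lean` with the rational map

  `g(x) = x + G'(x)/G(x) = U/V`,  `U = x·G + G'`, `V = G` (`G` replaced by its monic radical),

which has SIMPLE poles exactly at the roots of `G`, is unramified there and at `∞`, and fixes `∞`
(Scherr–Zieve Prop. 4 made explicit in genus `0`; suggested in this form by seat w5-d077 of the cell
abc-iut).  The cusp-destined set is `A' = g(A) ∪ g(critical points of g)`, and the composite in the
`(p, q)` format is the homogenised substitution of `NoncriticalBelyiSubst.lean`.

Result `NoncriticalBelyi.exists_belyi_noncritical_protect`: for a finite set `A` of algebraic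
numbers and a nonzero `G ∈ ℚ[x]` with no root in `A`, a coprime Belyi pair `(p, q)` over `ℚ` of
degree `n ≥ 1` with `β(A) ⊆ {0,1,∞}`, `β(∞) ∉ {0,1,∞}` unramified, `β(γ) ∉ {0,1,∞}` and `β`
unramified at every root `γ` of `G` (in any field over `ℚ` for the values), and `#β⁻¹{0,1,∞} = n + 2`.
No definitions, no named facts.
-/

namespace Literature.NumberTheory.DiophantineGeometry

open Polynomial Finset

namespace NoncriticalBelyi

/-- Polynomial expressions in an algebraic number are algebraic. [folklore] -/
private theorem isAlgebraic_aeval {z : ℂ} (hz : IsAlgebraic ℚ z) (F : ℚ[X]) :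
    IsAlgebraic ℚ (aeval z F) :=
  (IsIntegral.of_mem_of_fg _ hz.isIntegral.fg_adjoin_singleton _
    (aeval_mem_adjoin_singleton _ _)).isAlgebraic

/-- **Noncritical Belyi map on `ℙ¹_ℚ` protecting `∞` and the roots of a nonzero `G ∈ ℚ[x]`.**
See the module docstring. [cite: MochizukiNCBelyi2004, Thm 2.5] -/
theorem exists_belyi_noncritical_protect (A : Finset ℂ) (hA : ∀ a ∈ A, IsAlgebraic ℚ a)
    (G : ℚ[X]) (hG : G ≠ 0) (hGA : ∀ a ∈ A, aeval a G ≠ 0) :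
    ∃ (p q : ℚ[X]) (n : ℕ), 0 < n ∧ p.natDegree = n ∧ q.natDegree = n ∧ (p - q).natDegree = n ∧
      p.coeff (n - 1) * q.coeff n ≠ p.coeff n * q.coeff (n - 1) ∧ IsCoprime p q ∧
      (∀ z : ℂ, aeval z q ≠ 0 → aeval z (derivative p * q - p * derivative q) = 0 →
        aeval z p = 0 ∨ aeval z p = aeval z q) ∧
      (∀ a ∈ A, aeval a (p * q * (p - q)) = 0) ∧
      (∀ {K : Type} [Field K] [Algebra ℚ K] (γ : K), aeval γ G = 0 →
        aeval γ p ≠ 0 ∧ aeval γ q ≠ 0 ∧ aeval γ p ≠ aeval γ q) ∧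
      (∀ γ : ℂ, aeval γ G = 0 → aeval γ (derivative p * q - p * derivative q) ≠ 0) ∧
      ((p * q * (p - q)).map (algebraMap ℚ ℂ)).roots.toFinset.card = n + 2 := by
  classical
  -- pass to the radical `G₁` of `G`: separable, with the same roots in every field over `ℚ`
  set G₁ : ℚ[X] := UniqueFactorizationMonoid.radical G with hG₁
  have hG0 : G₁ ≠ 0 := UniqueFactorizationMonoid.radical_ne_zero
  have hG₁sep : G₁.Separable :=
    PerfectField.separable_iff_squarefree.2 UniqueFactorizationMonoid.squarefree_radical
  have hG₁root : ∀ {K : Type} [Field K] [Algebra ℚ K] (x : K), aeval x G₁ = 0 ↔ aeval x G = 0 := by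
    intro K _ _ x
    constructor
    · intro hx
      obtain ⟨h, hh⟩ := (UniqueFactorizationMonoid.radical_dvd_self : G₁ ∣ G)
      rw [hh, map_mul, hx, zero_mul]
    · intro hx
      obtain ⟨m, h, hh⟩ := UniqueFactorizationMonoid.exists_dvd_radical_self_pow hG
      have h0 : aeval x G₁ ^ m = 0 := by rw [← map_pow, hG₁, hh, map_mul, hx, zero_mul]
      exact eq_zero_of_pow_eq_zero h0
  -- the monic normalisation `V` of `G₁` and `U = X·V + V'`
  set V : ℚ[X] := G₁ * C (G₁.leadingCoeff)⁻¹ with hV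
  have hVm : V.Monic := monic_mul_leadingCoeff_inv hG0
  have hVsep : V.Separable := hG₁sep.mul_unit (isUnit_C.2 (isUnit_iff_ne_zero.2
    (inv_ne_zero (leadingCoeff_ne_zero.2 hG0))))
  have hVroot : ∀ {K : Type} [Field K] [Algebra ℚ K] (x : K), aeval x V = 0 ↔ aeval x G = 0 := by
    intro K _ _ x
    rw [hV, map_mul, aeval_C, mul_eq_zero, map_eq_zero_iff _ (algebraMap ℚ K).injective,
      inv_eq_zero, leadingCoeff_eq_zero, or_iff_left hG0, hG₁root]
  have hVrootC : ∀ x : ℂ, aeval x V = 0 ↔ aeval x G = 0 := fun x => hVroot x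
  set k : ℕ := V.natDegree with hk
  set U : ℚ[X] := X * V + derivative V with hU
  have hXV : (X * V).Monic := monic_X.mul hVm
  have hXVdeg : (X * V).natDegree = k + 1 := by
    rw [monic_X.natDegree_mul hVm, natDegree_X, hk]; ring
  have hUm : U.Monic := by
    refine Monic.add_of_left hXV (degree_lt_degree ?_)
    rw [hXVdeg]
    exact Nat.lt_succ_of_le ((natDegree_derivative_le V).trans (Nat.sub_le _ _))
  have hUdeg : U.natDegree = k + 1 := by
    rw [hU, natDegree_add_eq_left_of_natDegree_lt, hXVdeg]
    rw [hXVdeg]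
    exact Nat.lt_succ_of_le ((natDegree_derivative_le V).trans (Nat.sub_le _ _))
  -- `U(γ) = V'(γ) ≠ 0` at the roots of `V` (separability), in any field
  have hUroot : ∀ {K : Type} [Field K] [Algebra ℚ K] (x : K), aeval x V = 0 → aeval x U ≠ 0 := by
    intro K _ _ x hx
    rw [hU, map_add, map_mul, aeval_X, hx, mul_zero, zero_add]
    exact hVsep.aeval_derivative_ne_zero hx
  -- the Wronskian of `g = U/V` is a nonzero polynomial
  set Wg : ℚ[X] := derivative U * V - U * derivative V with hWg
  have hWg0 : Wg ≠ 0 := by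
    -- its coefficient in degree `2k` is `1`
    intro h0
    have hcoeff : Wg.coeff (k + k) = 1 := by
      have h1 : Wg = V * V + (derivative (derivative V) * V - derivative V * derivative V) := by
        rw [hWg, hU]; simp only [derivative_add, derivative_mul, derivative_X, one_mul]; ring
      rw [h1, coeff_add, coeff_mul_add_eq_of_natDegree_le le_rfl le_rfl, ← hk, hVm.coeff_natDegree,
        mul_one, add_eq_left]
      rcases Nat.eq_zero_or_pos k with hk0 | hkpos
      · have hc0 : V.coeff 0 = 1 := by
          have := hVm.coeff_natDegree; rwa [← hk, hk0] at this
        have hVdeg0 : V.natDegree = 0 := by rw [← hk0, hk]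
        have hVc : V = 1 := by
          rw [eq_C_of_natDegree_eq_zero hVdeg0, hc0, map_one]
        simp [hVc]
      · apply coeff_eq_zero_of_natDegree_lt
        refine lt_of_le_of_lt (natDegree_sub_le _ _) (max_lt ?_ ?_)
        · refine lt_of_le_of_lt natDegree_mul_le ?_
          have := natDegree_derivative_le (derivative V)
          have := natDegree_derivative_le V
          omega
        · refine lt_of_le_of_lt natDegree_mul_le ?_
          have := natDegree_derivative_le V
          omega
    rw [h0, coeff_zero] at hcoeff
    exact zero_ne_one hcoeff
  -- the new cusp-destined finite set `A' = g(A) ∪ g(critical points of g)`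
  have hWgC : Wg.map (algebraMap ℚ ℂ) ≠ 0 :=
    (Polynomial.map_ne_zero_iff (algebraMap ℚ ℂ).injective).2 hWg0
  set CP : Finset ℂ := (Wg.map (algebraMap ℚ ℂ)).roots.toFinset with hCP
  set g : ℂ → ℂ := fun x => aeval x U / aeval x V with hg
  set A' : Finset ℂ := (A ∪ CP).image g with hA'
  have hA'alg : ∀ y ∈ A', IsAlgebraic ℚ y := by
    intro y hy
    obtain ⟨x, hx, rfl⟩ := mem_image.1 hy
    have hxalg : IsAlgebraic ℚ x := by
      rcases mem_union.1 hx with hx | hx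
      · exact hA x hx
      · rw [hCP, Multiset.mem_toFinset, mem_roots hWgC, IsRoot.def, eval_map_algebraMap] at hx
        exact ⟨Wg, hWg0, hx⟩
    rw [hg]; dsimp only; rw [div_eq_mul_inv]
    exact ((isAlgebraic_aeval hxalg U).isIntegral.mul
      (isAlgebraic_aeval hxalg V).inv.isIntegral).isAlgebraic
  -- the `∞`-protecting Belyi pair for `A'`
  obtain ⟨P, Q, n, hn, hPn, hQn, hPQn, hunr, hcop, hcrit, hval, -⟩ :=
    exists_belyi_noncritical_infty_card A' hA'alg
  have hPc : P.coeff n ≠ 0 := by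
    rw [← hPn, coeff_natDegree]; exact leadingCoeff_ne_zero.2 (by rintro rfl; simp at hPn; omega)
  have hQc : Q.coeff n ≠ 0 := by
    rw [← hQn, coeff_natDegree]; exact leadingCoeff_ne_zero.2 (by rintro rfl; simp at hQn; omega)
  have hPQc : P.coeff n ≠ Q.coeff n := by
    intro h
    have h0 : (P - Q).coeff n = 0 := by rw [coeff_sub, h, sub_self]
    rw [← hPQn, coeff_natDegree, leadingCoeff_eq_zero] at h0
    rw [h0, natDegree_zero] at hPQn; omega
  -- the composite pair
  set HP : ℚ[X] := ∑ j ∈ range (n + 1), C (P.coeff j) * U ^ j * V ^ (n - j) with hHP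
  set HQ : ℚ[X] := ∑ j ∈ range (n + 1), C (Q.coeff j) * U ^ j * V ^ (n - j) with hHQ
  have hHPQ : HP - HQ = ∑ j ∈ range (n + 1), C ((P - Q).coeff j) * U ^ j * V ^ (n - j) := by
    rw [hHP, hHQ, ← sum_sub_distrib]
    refine sum_congr rfl fun j _ => ?_
    rw [coeff_sub, map_sub]; ring
  set N : ℕ := n * (k + 1) with hN
  have hNpos : 0 < N := Nat.mul_pos hn (Nat.succ_pos k)
  have hHPtop : HP.coeff N = P.coeff n := homSubst₂_coeff_top P n U V hUm hUdeg hVm rfl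
  have hHQtop : HQ.coeff N = Q.coeff n := homSubst₂_coeff_top Q n U V hUm hUdeg hVm rfl
  have hHPdeg : HP.natDegree = N :=
    natDegree_eq_of_le_of_coeff_ne_zero (homSubst₂_natDegree_le P n U V hUm hUdeg hVm rfl)
      (by rw [hHPtop]; exact hPc)
  have hHQdeg : HQ.natDegree = N :=
    natDegree_eq_of_le_of_coeff_ne_zero (homSubst₂_natDegree_le Q n U V hUm hUdeg hVm rfl)
      (by rw [hHQtop]; exact hQc)
  have hHPQdeg : (HP - HQ).natDegree = N := by
    rw [hHPQ]
    exact natDegree_eq_of_le_of_coeff_ne_zero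
      (homSubst₂_natDegree_le (P - Q) n U V hUm hUdeg hVm rfl)
      (by rw [homSubst₂_coeff_top (P - Q) n U V hUm hUdeg hVm rfl, coeff_sub]
          exact sub_ne_zero.2 hPQc)
  -- evaluation facts
  have hroot_eval : ∀ {K : Type} [Field K] [Algebra ℚ K] (x : K), aeval x V = 0 →
      aeval x HP = algebraMap ℚ K (P.coeff n) * aeval x U ^ n ∧
        aeval x HQ = algebraMap ℚ K (Q.coeff n) * aeval x U ^ n := fun x hx =>
    ⟨aeval_homSubst₂_of_root P n U V x hx, aeval_homSubst₂_of_root Q n U V x hx⟩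
  have hoff_eval : ∀ x : ℂ, aeval x V ≠ 0 →
      aeval x HP = aeval x V ^ n * aeval (g x) P ∧ aeval x HQ = aeval x V ^ n * aeval (g x) Q :=
    fun x hx => ⟨aeval_homSubst₂ P n U V hPn.le x hx, aeval_homSubst₂ Q n U V hQn.le x hx⟩
  -- the protected roots, field-free
  have hprot : ∀ {K : Type} [Field K] [Algebra ℚ K] (γ : K), aeval γ G = 0 →
      aeval γ HP ≠ 0 ∧ aeval γ HQ ≠ 0 ∧ aeval γ HP ≠ aeval γ HQ := by
    intro K _ _ γ hγ
    have hVγ : aeval γ V = 0 := (hVroot γ).2 hγ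
    have hUγ : aeval γ U ^ n ≠ 0 := pow_ne_zero _ (hUroot γ hVγ)
    obtain ⟨h1, h2⟩ := hroot_eval γ hVγ
    have hinjK := (algebraMap ℚ K).injective
    rw [h1, h2]
    refine ⟨mul_ne_zero ((map_ne_zero_iff _ hinjK).2 hPc) hUγ,
      mul_ne_zero ((map_ne_zero_iff _ hinjK).2 hQc) hUγ, fun h => hPQc (hinjK ?_)⟩
    exact mul_right_cancel₀ hUγ h
  -- non-ramification at the poles of `g`
  have hpoleW : ∀ γ : ℂ, aeval γ G = 0 → aeval γ (derivative HP * HQ - HP * derivative HQ) ≠ 0 := by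
    intro γ hγ
    have hVγ : aeval γ V = 0 := (hVrootC γ).2 hγ
    exact wronskian_homSubst₂_ne_zero_of_pole n U V P Q hPn.le hQn.le hn hQc hunr γ hVγ
      (hVsep.aeval_derivative_ne_zero hVγ) (hUroot γ hVγ)
  -- values on `A'` translate to values of `(HP, HQ)`
  have hA'val : ∀ x : ℂ, x ∈ A ∪ CP → aeval x V ≠ 0 →
      aeval x HP = 0 ∨ aeval x HQ = 0 ∨ aeval x HP = aeval x HQ := by
    intro x hx hVx
    have hgx : g x ∈ A' := mem_image.2 ⟨x, hx, rfl⟩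
    have h := hval (g x) hgx
    obtain ⟨h1, h2⟩ := hoff_eval x hVx
    rw [map_mul, map_mul, map_sub, mul_eq_zero, mul_eq_zero, sub_eq_zero] at h
    rw [h1, h2]
    rcases h with (h | h) | h
    · exact Or.inl (by rw [h, mul_zero])
    · exact Or.inr (Or.inl (by rw [h, mul_zero]))
    · exact Or.inr (Or.inr (by rw [h]))
  have hbel : ∀ z : ℂ, aeval z HQ ≠ 0 → aeval z (derivative HP * HQ - HP * derivative HQ) = 0 →
      aeval z HP = 0 ∨ aeval z HP = aeval z HQ := by
    intro z hqz hWz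
    by_cases hVz : aeval z V = 0
    · exact absurd hWz (hpoleW z ((hVrootC z).1 hVz))
    · rcases wronskian_homSubst₂_eq_zero n U V P Q hPn.le hQn.le z hVz hqz hWz with h | h
      · -- `z` is a critical point of `g`
        have hzCP : z ∈ CP := by
          rw [hCP, Multiset.mem_toFinset, mem_roots hWgC, IsRoot.def, eval_map_algebraMap]; exact h
        rcases hA'val z (mem_union.2 (Or.inr hzCP)) hVz with h1 | h1 | h1
        · exact Or.inl h1
        · exact absurd h1 hqz
        · exact Or.inr h1
      · -- `g z` is a critical point of `P/Q`
        obtain ⟨h1, h2⟩ := hoff_eval z hVz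
        have hQg : aeval (g z) Q ≠ 0 := fun h0 => hqz (by rw [h2, h0, mul_zero])
        rcases hcrit (g z) hQg h with h3 | h3
        · left; rw [h1, h3, mul_zero]
        · right; rw [h1, h2, h3]
  have hcopH : IsCoprime HP HQ := by
    rw [Polynomial.isCoprime_iff_aeval_ne_zero_of_isAlgClosed ℚ ℂ]
    intro z
    by_cases hVz : aeval z V = 0
    · exact Or.inl (hprot z ((hVrootC z).1 hVz)).1
    · obtain ⟨h1, h2⟩ := hoff_eval z hVz
      have hVn : aeval z V ^ n ≠ 0 := pow_ne_zero _ hVz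
      rcases (Polynomial.isCoprime_iff_aeval_ne_zero_of_isAlgClosed ℚ ℂ P Q).1 hcop (g z) with h | h
      · exact Or.inl (by rw [h1]; exact mul_ne_zero hVn h)
      · exact Or.inr (by rw [h2]; exact mul_ne_zero hVn h)
  have hunrH : HP.coeff (N - 1) * HQ.coeff N ≠ HP.coeff N * HQ.coeff (N - 1) := by
    rw [hHPtop, hHQtop, homSubst₂_coeff_pred P n U V hUm hUdeg hVm rfl hn,
      homSubst₂_coeff_pred Q n U V hUm hUdeg hVm rfl hn]
    intro h; apply hunr; linear_combination h
  refine ⟨HP, HQ, N, hNpos, hHPdeg, hHQdeg, hHPQdeg, hunrH, hcopH, hbel, ?_, hprot, hpoleW,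
    card_cusp_preimages HP HQ N hNpos hHPdeg hHQdeg hHPQdeg hunrH hcopH hbel⟩
  -- `A ↦ {0, 1, ∞}`
  intro a ha
  have hVa : aeval a V ≠ 0 := fun h => hGA a ha ((hVrootC a).1 h)
  rw [map_mul, map_mul, map_sub]
  rcases hA'val a (mem_union.2 (Or.inl ha)) hVa with h | h | h
  · rw [h, zero_mul, zero_mul]
  · rw [h, mul_zero, zero_mul]
  · rw [h, sub_self, mul_zero]

end NoncriticalBelyi

end Literature.NumberTheory.DiophantineGeometry
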